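import Summits.QuantumFields.BalabanUV.Beta.CombChartJointEndTablesFold

/-!
# `BalabanUV.Beta.FP.StepKernelWardDataTables` — road «FP» for binder row D1, ROUTE T, (L4′) OF TID § F.10, OWNER #30a: **hW ∧ hR TWINS OF ROOTS F′ (`CombChartJointEndTables`) AND F″ (`CombChartJointEndTablesFold`) — table letters, tabs-generic**

WHY (road «FP», ROUTE T, TID § F.10 (L4′); OWNER #30).  The (F1) END socket #28 `FP/StepRecursionFeed` §5 concludes M‴'s `htel : D1Tel Lc (JsB12CombShSym hLc N
(symTablesAn1S2 3 Lc cΛ) cΛ cB) Jc` from the road's rows (L1)(L2′) AND an4's side binders (L4′) `hT0 hT1` — (T0)(T1) of the step kernels of the (III′) literal of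
record.  Those follow (β-lead's `ScalewiseVectorSeam.scalewiseData_of_printed_flip` at an4's uniform decay `hdec_TbalOf`) from hW ∧ hR of the flipped step kernels,
which the row-D1 OWNER's ROOT chain F′ … M‴ (`CombChartJointEndTables` … `CombChartJointEndReflTablesAn1S2N`, `CombRemainderParityAll`) proves LETTER BY LETTER —
but only INSIDE `D1Drift`-concluding roots (`CombChartWardEnd` §2 ∕ `CombChartJointEnd` §3 are letter-relative).  Files #30a–#30d re-trace that chain with the
conclusion replaced by hW ∧ hR (one TWIN theorem per root: same letters, same body, callee ↦ callee's twin, route binders dropped), ending at the pinned literal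
with M‴'s own scalars only (`Odd Lc`, `2 ≤ Lc`, `2 ≤ N`, `hΛ`, `hcB`); #30d then DISCHARGES (L4′) and re-cuts #28 §5 to (L1)(L2′).

WHAT (this file).  `wardRefl_JsB12CombShSym_of_wardTables_reflLetters` (twin of `CombChartJointEndTables`) ∕ `wardRefl_JsB12CombShSym_of_wardTables_multiplierTable_reflLetters` (twin of `CombChartJointEndTablesFold`) — statements = the originals' letters VERBATIM
(route binders `a ha h12 h126 hSL k hμν hNc Jc htel hc hMwin hML hrep` dropped; `hL2` dropped where it only fed the route), conclusion = hW ∧ hR; proofs = the originals' bodies.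

HONEST DEPENDENCY (page 1, mandatory): continuum YM on T⁴ ⇐ BetaPertH ∧ nine spine estimates (0/9 proved); BetaPertH ⇐ (D1) ∧ (D4) ∧ CAP+tail;
G-an2-4 gates asym, D1 and NE2/3/4.  HONEST FRAMING (cell contract, verbatim): «discharging `BetaPertH` makes Bałaban's UV stability UNCONDITIONAL —
a real constructive-QFT result; it is NOT the continuum limit and NOT the Clay problem.»  ABSOLUTE RULE (cell charter, verbatim): «No internally-minted
statement may enter as a cited fact. Every hypothesis is either kernel-proved in this package or a verbatim quotation of a PUBLISHED theorem with page
reference. The manuscript(s) under audit are NOT citable for their own disputed steps — they are the thing under adjudication; programme-internal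
(2001/route/tribunal) claims are never citable.»  [folklore] composition BY NAME of landed modules (the row-D1 OWNER an2's ROOT chain F′ … M‴ and its letter
dischargers, the β-lead's `ScalewiseVectorSeam`, an4's `HessianTelescopingKKT`); no `def`, no `def … : Prop`, nothing cited, 0 sorry; nothing of Bałaban's
asserted; 0 estimates; 0∕4 row-D1 binders DISCHARGED BY THIS FILE (hW ∕ hR at the locks were already theorems INSIDE M‴'s chain — these files only EXPOSE them;
`D1Tel` ∕ `D1Rep` stay the roads'); ROOT M‴ p325680 untouched; NOT (T-ID), NOT SDF, NOT D1, NOT BetaPertH, NOT continuum, NOT Clay.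
Road «FP» OWNER, b2b-balaban-beta-d1-p3 gen 23, 2026-08-22.  No existing file touched.
-/

noncomputable section

open Summit.QuantumFields.BalabanUV.Beta.CombChartWardEnd (wardTransversal_flipK_TbalOf_JsB12CombShSym_rel_parity)
open Summit.QuantumFields.BalabanUV.Beta.CombChartJointEnd (axisReflectionCovariant_flipK_TbalOf_JsB12CombShSym_of_reflLettersRem)
open Finset
open scoped BigOperators
open Literature.MathematicalPhysics.QuantumFieldTheory
open Literature.MathematicalPhysics.QuantumFieldTheory.Balaban1983to89
open Literature.MathematicalPhysics.QuantumFieldTheory.Balaban1983to89.Beta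
open ExpKernelCalculus (MKer VertexFamily comp tadpole)
open PolarizationSign (reflSign WardTransversal AxisReflectionCovariant)
open KernelReflection (refK)
open ResolventReflection (bref Φ)
open AffineAveraging (box toSite)
open AveragingContoursRooted (ctr)
open OneStepResolventKernel (Fib LocStencil)
open OneStepKernelFamily (vertexOfK TbalOf flipK)
open KernelWard (divV divW)
open StepJetData (mfNeg wilsonA)
open BalabanStepJetsSucc (wVH)
open SecondOrderResponse (dM)
open BalabanStepW2 (M2Of wB2)
open WilsonBiStencil (wilsonW₂)
open WilsonVertex2Sym (wsym22)
open Summit.QuantumFields.BalabanUV.Beta.TameKernelCalculus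
open Summit.QuantumFields.BalabanUV.Beta.ChartConjugation (conjV conjW)
open Summit.QuantumFields.BalabanUV.Beta.AxialDressingRooted (one_le_of_neZero axEc)
open Summit.QuantumFields.BalabanUV.Beta.AveragingWardRootedStencils (legInd)
open Summit.QuantumFields.BalabanUV.Beta.SymmetrisedStepJets (SymTables)
open Summit.QuantumFields.BalabanUV.Beta.SymShiftedSpread (bhKStepSh)
open Summit.QuantumFields.BalabanUV.Beta.BorderedHessian (sgnK bhK spr_bhK stepScale diagK)
open Summit.QuantumFields.BalabanUV.Beta.E3ContactGenerator (ctGenM)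
open Summit.QuantumFields.BalabanUV.Beta.KernelWardRelative (loc_zero comp_zero_left)
open StepDriftWitness (comp_zero_right)
open Summit.QuantumFields.BalabanUV.Beta.KernelWardLevels (loc_diagK_smul_sum_legInd)
open Summit.QuantumFields.BalabanUV.Beta.WardLocusRecursiveStep (conjW_zero_zero_zero)
open Summit.QuantumFields.BalabanUV.Beta.VertexReflectionContact (smul_diagK)
open Summit.QuantumFields.BalabanUV.Beta.RowD1JointEndSym (locStencil_smul_diagK_ctGenM)
open Summit.QuantumFields.BalabanUV.Beta.RelInvNullShift (spr_add)
open Summit.QuantumFields.BalabanUV.Beta.DshAn1 (Dsh spr_Dsh linSym04At hVd_iff)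
open Summit.QuantumFields.BalabanUV.Beta.CombChartStepJets (GcombSh ScombOf SpureCombOf JsComb0Of_S JsComb0Of_W JsB12CombSh0 JsB12CombSh0_eq)
open Summit.QuantumFields.BalabanUV.Beta.CombChartJointEnd (JsB12CombShSym)
open Summit.QuantumFields.BalabanUV.Beta.WardLocusCombShift (hSd_JsB12CombSh0)
open Summit.QuantumFields.BalabanUV.Beta.ReflectionLocusCombShift (hSrC_JsB12CombSh0)
open Summit.QuantumFields.BalabanUV.Beta.WardLocusCombSecondOrder (exists_kernelLaws_WcombOf_of_letters)
open Summit.QuantumFields.BalabanUV.Beta.SpineRooted (M1Of)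
open Summit.QuantumFields.BalabanUV.Beta.LagrangeFoldComb (dM_SpureCombOf_M1Of_eq_vertexOfK_ScombOf)

namespace Summit.QuantumFields.BalabanUV.Beta.FP.StepKernelWardDataTables

variable {Lc : ℕ} [NeZero Lc]

/-- [folklore] **hW ∧ hR TWIN of `CombChartJointEndTables.d1Drift_JsB12CombShSym_of_wardTables_reflLetters_D1Tel_D1Rep`** (ROOT chain F′ … M‴ of row D1, chart (III′)): the SAME letters, the conclusion
replaced by the Ward transversality and the axis-reflection covariance of the flipped step kernels `flipK (TbalOf Lc (JsB12CombShSym …) j)`, every `j`;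
proof = the original body with its callee replaced by the callee's twin (route binders dropped). -/
theorem wardRefl_JsB12CombShSym_of_wardTables_reflLetters (hLc : Odd Lc) (N : ℕ) (tabs : SymTables 3 Lc) (cΛ cB : ℝ)
    -- hW, first order: the (0.4) stencil Ward law of `tabs.V` ((S-V)⁰⁴)
    (hVd04 : ∀ u : Fin 4 → ℤ, divV tabs.V u = conjV (mfNeg (linSym04At (ctr 4 Lc) Lc)) (diagK (legInd (ctr 4 Lc) u)))
    -- hW, SECOND ORDER — (c1)′ at the comb-chart resolvents (LOCATED OPEN), (Sp)(Mp), the table letters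
    (hc1 : ∀ (j : ℕ) (κ : Fin 4) (u : Fin 4 → ℤ),
      dM (GcombSh Lc j) Lc (SpureCombOf tabs ((Lc : ℝ) ^ (3 + 1)) (-((Lc : ℝ) ^ (3 + 1) * (1 / 2) * (Lc : ℝ) ^ (3 + 1))) cΛ j) (tabs.M j) κ u = vertexOfK (GcombSh Lc j) Lc (ScombOf tabs ((Lc : ℝ) ^ (3 + 1)) (-((Lc : ℝ) ^ (3 + 1) * (1 / 2) * (Lc : ℝ) ^ (3 + 1))) cΛ j) κ u)
    (hSp : ∀ (j : ℕ) (κ : Fin 4) (u : Fin 4 → ℤ), trK (SpureCombOf tabs ((Lc : ℝ) ^ (3 + 1)) (-((Lc : ℝ) ^ (3 + 1) * (1 / 2) * (Lc : ℝ) ^ (3 + 1))) cΛ j κ u) = -sgnK (SpureCombOf tabs ((Lc : ℝ) ^ (3 + 1)) (-((Lc : ℝ) ^ (3 + 1) * (1 / 2) * (Lc : ℝ) ^ (3 + 1))) cΛ j κ u))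
    (hMp : ∀ (j : ℕ) (ρ : Fin 4) (w : Fin 4 → ℤ), trK (tabs.M j ρ w) = -sgnK (tabs.M j ρ w))
    (RW RW'' : (Fin 4 → ℤ) → Fin 4 → (Fin 4 → ℤ) → MKer 4 (Fib 3))
    (RB RB'' : ℕ → (Fin 4 → ℤ) → Fin 4 → (Fin 4 → ℤ) → MKer 4 (Fib 3))
    (RM : ℕ → (Fin 4 → ℤ) → Fin 4 → (Fin 4 → ℤ) → MKer 4 (Fib 3))
    (hcls0 : ∃ C δ : ℝ, 0 < δ ∧ (∀ Y, LocStencil (RW Y) C δ) ∧ (∀ Y, LocStencil (RW'' Y) C δ) ∧ (∀ Y, LocStencil (RB 0 Y) C δ) ∧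
      (∀ Y, LocStencil (RB'' 0 Y) C δ) ∧ (∀ y, VertexFamily (RM 0 y) Lc C δ))
    (hclsS : ∀ j : ℕ, ∃ C δ : ℝ, 0 < δ ∧ (∀ Y, LocStencil (RB (j + 1) Y) C δ) ∧ (∀ Y, LocStencil (RB'' (j + 1) Y) C δ) ∧
      (∀ y, VertexFamily (RM (j + 1) y) Lc C δ))
    (hRWp : ∀ Y κ u, trK (RW Y κ u) = -sgnK (RW Y κ u)) (hRW''p : ∀ Y κ u, trK (RW'' Y κ u) = -sgnK (RW'' Y κ u))
    (hRBp : ∀ j Y κ u, trK (RB j Y κ u) = -sgnK (RB j Y κ u)) (hRB''p : ∀ j Y κ u, trK (RB'' j Y κ u) = -sgnK (RB'' j Y κ u))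
    (hRMp : ∀ j y ρ' w, trK (RM j y ρ' w) = -sgnK (RM j y ρ' w))
    (hWil : ∀ (Y : Fin 4 → ℤ) (κ' : Fin 4) (u' : Fin 4 → ℤ),
      (stepScale 3 Lc 0 * (Lc : ℝ) ^ (3 + 1))⁻¹ • ∑ v ∈ box (3 + 1) Lc,
          divV (fun κ u => ((Lc : ℝ) ^ 8) • wilsonW₂ 3 ((8 * (N : ℝ) ^ 2)⁻¹ • wsym22 N) κ u κ' u') ((Lc : ℤ) • Y + toSite v) =
        comp (((Lc : ℝ) ^ (3 + 1)) • wilsonA 3 κ' u') (diagK ((1 / 2 : ℝ) • ∑ v ∈ box (3 + 1) Lc, legInd (ctr (3 + 1) Lc) ((Lc : ℤ) • Y + toSite v)))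
          - comp (diagK ((1 / 2 : ℝ) • ∑ v ∈ box (3 + 1) Lc, legInd (ctr (3 + 1) Lc) ((Lc : ℤ) • Y + toSite v))) (((Lc : ℝ) ^ (3 + 1)) • wilsonA 3 κ' u') + RW Y κ' u')
    (hWil'' : ∀ (Y : Fin 4 → ℤ) (κ : Fin 4) (u : Fin 4 → ℤ),
      (stepScale 3 Lc 0 * (Lc : ℝ) ^ (3 + 1))⁻¹ • ∑ v ∈ box (3 + 1) Lc,
          divV (fun κ' u' => ((Lc : ℝ) ^ 8) • wilsonW₂ 3 ((8 * (N : ℝ) ^ 2)⁻¹ • wsym22 N) κ u κ' u') ((Lc : ℤ) • Y + toSite v) =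
        comp (((Lc : ℝ) ^ (3 + 1)) • wilsonA 3 κ u) (diagK ((1 / 2 : ℝ) • ∑ v ∈ box (3 + 1) Lc, legInd (ctr (3 + 1) Lc) ((Lc : ℤ) • Y + toSite v)))
          - comp (diagK ((1 / 2 : ℝ) • ∑ v ∈ box (3 + 1) Lc, legInd (ctr (3 + 1) Lc) ((Lc : ℤ) • Y + toSite v))) (((Lc : ℝ) ^ (3 + 1)) • wilsonA 3 κ u) + RW'' Y κ u)
    (hBord0 : ∀ (Y : Fin 4 → ℤ) (κ' : Fin 4) (u' : Fin 4 → ℤ),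
      (stepScale 3 Lc 0 * (Lc : ℝ) ^ (3 + 1))⁻¹ • ∑ v ∈ box (3 + 1) Lc, divV (fun κ u => cB • tabs.vh₂S κ u κ' u') ((Lc : ℤ) • Y + toSite v) =
        comp ((-((Lc : ℝ) ^ (3 + 1) * (1 / 2) * (Lc : ℝ) ^ (3 + 1))) • tabs.V κ' u') (diagK ((1 / 2 : ℝ) • ∑ v ∈ box (3 + 1) Lc, legInd (ctr (3 + 1) Lc) ((Lc : ℤ) • Y + toSite v)))
          - comp (diagK ((1 / 2 : ℝ) • ∑ v ∈ box (3 + 1) Lc, legInd (ctr (3 + 1) Lc) ((Lc : ℤ) • Y + toSite v))) ((-((Lc : ℝ) ^ (3 + 1) * (1 / 2) * (Lc : ℝ) ^ (3 + 1))) • tabs.V κ' u') + RB 0 Y κ' u')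
    (hBord0'' : ∀ (Y : Fin 4 → ℤ) (κ : Fin 4) (u : Fin 4 → ℤ),
      (stepScale 3 Lc 0 * (Lc : ℝ) ^ (3 + 1))⁻¹ • ∑ v ∈ box (3 + 1) Lc, divV (fun κ' u' => cB • tabs.vh₂S κ u κ' u') ((Lc : ℤ) • Y + toSite v) =
        comp ((-((Lc : ℝ) ^ (3 + 1) * (1 / 2) * (Lc : ℝ) ^ (3 + 1))) • tabs.V κ u) (diagK ((1 / 2 : ℝ) • ∑ v ∈ box (3 + 1) Lc, legInd (ctr (3 + 1) Lc) ((Lc : ℤ) • Y + toSite v)))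
          - comp (diagK ((1 / 2 : ℝ) • ∑ v ∈ box (3 + 1) Lc, legInd (ctr (3 + 1) Lc) ((Lc : ℤ) • Y + toSite v))) ((-((Lc : ℝ) ^ (3 + 1) * (1 / 2) * (Lc : ℝ) ^ (3 + 1))) • tabs.V κ u) + RB'' 0 Y κ u)
    (hBordS : ∀ (j : ℕ) (Y : Fin 4 → ℤ) (κ' : Fin 4) (u' : Fin 4 → ℤ),
      (stepScale 3 Lc (j + 1) * (Lc : ℝ) ^ (3 + 1))⁻¹ • ∑ v ∈ box (3 + 1) Lc, divV (fun κ u => (cB * wB2 3 Lc (j + 1)) • tabs.vh₂S κ u κ' u') ((Lc : ℤ) • Y + toSite v) =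
        comp (((-((Lc : ℝ) ^ (3 + 1) * (1 / 2) * (Lc : ℝ) ^ (3 + 1))) * wVH 3 Lc (j + 1)) • tabs.V κ' u') (diagK ((1 / 2 : ℝ) • ∑ v ∈ box (3 + 1) Lc, legInd (ctr (3 + 1) Lc) ((Lc : ℤ) • Y + toSite v)))
          - comp (diagK ((1 / 2 : ℝ) • ∑ v ∈ box (3 + 1) Lc, legInd (ctr (3 + 1) Lc) ((Lc : ℤ) • Y + toSite v))) (((-((Lc : ℝ) ^ (3 + 1) * (1 / 2) * (Lc : ℝ) ^ (3 + 1))) * wVH 3 Lc (j + 1)) • tabs.V κ' u') + RB (j + 1) Y κ' u')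
    (hBordS'' : ∀ (j : ℕ) (Y : Fin 4 → ℤ) (κ : Fin 4) (u : Fin 4 → ℤ),
      (stepScale 3 Lc (j + 1) * (Lc : ℝ) ^ (3 + 1))⁻¹ • ∑ v ∈ box (3 + 1) Lc, divV (fun κ' u' => (cB * wB2 3 Lc (j + 1)) • tabs.vh₂S κ u κ' u') ((Lc : ℤ) • Y + toSite v) =
        comp (((-((Lc : ℝ) ^ (3 + 1) * (1 / 2) * (Lc : ℝ) ^ (3 + 1))) * wVH 3 Lc (j + 1)) • tabs.V κ u) (diagK ((1 / 2 : ℝ) • ∑ v ∈ box (3 + 1) Lc, legInd (ctr (3 + 1) Lc) ((Lc : ℤ) • Y + toSite v)))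
          - comp (diagK ((1 / 2 : ℝ) • ∑ v ∈ box (3 + 1) Lc, legInd (ctr (3 + 1) Lc) ((Lc : ℤ) • Y + toSite v))) (((-((Lc : ℝ) ^ (3 + 1) * (1 / 2) * (Lc : ℝ) ^ (3 + 1))) * wVH 3 Lc (j + 1)) • tabs.V κ u) + RB'' (j + 1) Y κ u)
    (hM₂ : ∀ (j : ℕ) (y : Fin 4 → ℤ) (ρ' : Fin 4) (w : Fin 4 → ℤ),
      (stepScale 3 Lc j * (Lc : ℝ) ^ (3 + 1))⁻¹ • ∑ v ∈ box (3 + 1) Lc, divV (fun κ u => M2Of 3 Lc tabs.mixFF j κ u ρ' w) ((Lc : ℤ) • y + toSite v) =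
        comp (tabs.M j ρ' w) (diagK ((1 / 2 : ℝ) • ∑ v ∈ box (3 + 1) Lc, legInd (ctr (3 + 1) Lc) ((Lc : ℤ) • y + toSite v))) - comp (diagK ((1 / 2 : ℝ) • ∑ v ∈ box (3 + 1) Lc, legInd (ctr (3 + 1) Lc) ((Lc : ℤ) • y + toSite v))) (tabs.M j ρ' w) + RM j y ρ' w)
    -- hR, first order: the tables' REFLECTION letters (V-r)(V-ff0)(H-r)
    (hVfm : ∀ (α κ' : Fin 4) (u x z : Fin 4 → ℤ) (β m : Fin 4), tabs.V κ' (bref α κ' u) x z (Sum.inl β) (Sum.inr m) =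
      (reflSign α κ' • refK (Φ (d := 3) Lc α) (tabs.V κ' u + conjV (bhK (d := 3) Lc + Dsh Lc)
        ((((Lc : ℝ) ^ 4)⁻¹) • diagK (ctGenM 3 (bhK Lc + Dsh Lc) α Lc κ' u)))) x z (Sum.inl β) (Sum.inr m))
    (hVmf : ∀ (α κ' : Fin 4) (u x z : Fin 4 → ℤ) (m β : Fin 4), tabs.V κ' (bref α κ' u) x z (Sum.inr m) (Sum.inl β) =
      (reflSign α κ' • refK (Φ (d := 3) Lc α) (tabs.V κ' u + conjV (bhK (d := 3) Lc + Dsh Lc)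
        ((((Lc : ℝ) ^ 4)⁻¹) • diagK (ctGenM 3 (bhK Lc + Dsh Lc) α Lc κ' u)))) x z (Sum.inr m) (Sum.inl β))
    (hVmm : ∀ (α κ' : Fin 4) (u x z : Fin 4 → ℤ) (m m' : Fin 4), tabs.V κ' (bref α κ' u) x z (Sum.inr m) (Sum.inr m') =
      (reflSign α κ' • refK (Φ (d := 3) Lc α) (tabs.V κ' u + conjV (bhK (d := 3) Lc + Dsh Lc)
        ((((Lc : ℝ) ^ 4)⁻¹) • diagK (ctGenM 3 (bhK Lc + Dsh Lc) α Lc κ' u)))) x z (Sum.inr m) (Sum.inr m'))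
    (hV0 : ∀ (κ : Fin 4) (w x z : Fin 4 → ℤ) (β β' : Fin 4), tabs.V κ w x z (Sum.inl β) (Sum.inl β') = 0)
    (hHr : ∀ (α μ : Fin 4) (y : Fin 4 → ℤ), tabs.H μ (bref α μ y) = reflSign α μ • refK (Φ (d := 3) Lc α) (tabs.H μ y))
    -- the first-order contact coefficient, displayed
    (γ : ℕ → ℝ) (hγ : ∀ j, γ j = -((Lc : ℝ) ^ 8 / 2) * wVH 3 Lc j / (stepScale 3 Lc j * (Lc : ℝ) ^ 4))
    -- hR, second order: the reflection letter (Wr-conj-rem) of the undressed comb-chart jets with the PINNED first-order contacts, diagonal `X₂`, tadpole-null remainder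
    (x₂ : ℕ → Fin 4 → Fin 4 → (Fin 4 → ℤ) → Fin 4 → (Fin 4 → ℤ) → (Fin 4 → ℤ) → Fib 3 → ℝ)
    (hX₂ : ∀ j α μ y ν y', Loc (diagK (x₂ j α μ y ν y')))
    (Rm : ℕ → Fin 4 → Fin 4 → (Fin 4 → ℤ) → Fin 4 → (Fin 4 → ℤ) → MKer 4 (Fib 3))
    (hRmL : ∀ j α μ y ν y', Loc (Rm j α μ y ν y'))
    (hRm0 : ∀ j α μ y ν y', tadpole (GcombSh Lc j) (Rm j α μ y ν y') = 0)
    (hWrC : ∀ (j : ℕ) (α μ : Fin 4) (y : Fin 4 → ℤ) (ν : Fin 4) (y' : Fin 4 → ℤ),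
      (JsB12CombSh0 hLc N tabs cΛ cB j).W μ (bref α μ y) ν (bref α ν y') = (reflSign α μ * reflSign α ν) • refK (Φ Lc α)
        ((JsB12CombSh0 hLc N tabs cΛ cB j).W μ y ν y' +
          conjW (bhKStepSh 3 Lc (Dsh Lc) j) (vertexOfK (GcombSh Lc j) Lc (JsB12CombSh0 hLc N tabs cΛ cB j).S μ y)
            (vertexOfK (GcombSh Lc j) Lc (JsB12CombSh0 hLc N tabs cΛ cB j).S ν y')
            (vertexOfK (GcombSh Lc j) Lc (fun κ u => diagK (fun p a => γ j * ctGenM 3 (bhK Lc + Dsh Lc) α Lc κ u p a)) μ y)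
            (vertexOfK (GcombSh Lc j) Lc (fun κ u => diagK (fun p a => γ j * ctGenM 3 (bhK Lc + Dsh Lc) α Lc κ u p a)) ν y')
            (diagK (x₂ j α μ y ν y')) + Rm j α μ y ν y')) :
    (∀ j : ℕ, WardTransversal (flipK (TbalOf Lc (JsB12CombShSym hLc N tabs cΛ cB) j))) ∧
      (∀ j : ℕ, AxisReflectionCovariant (flipK (TbalOf Lc (JsB12CombShSym hLc N tabs cΛ cB) j))) := by
  have hLc1 : 1 ≤ Lc := one_le_of_neZero Lc
  have hVd := (hVd_iff Lc (divV tabs.V)).2 hVd04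
  have hcE₂ : ((Lc : ℝ) ^ 8) = (Lc : ℝ) ^ (2 * (3 + 1)) := by norm_num
  -- (Wd): the second-order Ward kernel law of the literal's W-tables from the table letters
  obtain ⟨Nr, hcls, hpar, hlaw⟩ := exists_kernelLaws_WcombOf_of_letters (d := 3) tabs hVd cΛ cB hcE₂ ((8 * (N : ℝ) ^ 2)⁻¹ • wsym22 N) hc1 hSp hMp hcls0 hclsS
    hRWp hRW''p hRBp hRB''p hRMp hWil hWil'' hBord0 hBord0'' hBordS hBordS'' hM₂
  have epin : -((Lc : ℝ) ^ (3 + 1) * (1 / 2) * (Lc : ℝ) ^ (3 + 1)) = -((Lc : ℝ) ^ 8 / 2) := by ring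
  have hWd : ∀ (j : ℕ) (y : Fin 4 → ℤ) (ν : Fin 4) (y' : Fin 4 → ℤ),
      divW (JsB12CombSh0 hLc N tabs cΛ cB j).W y ν y' =
        conjW (bhKStepSh 3 Lc (Dsh Lc) j) 0 (vertexOfK (GcombSh Lc j) Lc (JsB12CombSh0 hLc N tabs cΛ cB j).S ν y')
          (diagK ((1 / 2 : ℝ) • ∑ v ∈ box 4 Lc, legInd (ctr 4 Lc) ((Lc : ℤ) • y + toSite v))) 0 0 + Nr j y ν y' := by
    intro j y ν y'
    have h1 := hlaw j y ν y'
    rw [hc1 j ν y', epin] at h1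
    rw [conjW_zero_zero_zero, JsB12CombSh0_eq, JsComb0Of_W, JsComb0Of_S]
    exact h1
  have hEX₂ : ∀ (j : ℕ) (y : Fin 4 → ℤ) (ν : Fin 4) (y' : Fin 4 → ℤ),
      comp (axEc (ctr 4 Lc) Lc) (0 : MKer 4 (Fib 3)) = comp (0 : MKer 4 (Fib 3)) (axEc (ctr 4 Lc) Lc) := by
    intro j y ν y'
    rw [comp_zero_left, comp_zero_right]
  -- (Sr-conj): the first-order reflection letter from the table letters, contacts pinned
  obtain ⟨δB, CB, hδB, -, hBd⟩ := E3GenericReflection.Spr.decays' (spr_add (spr_bhK (d := 3) hLc1) (spr_Dsh hLc1))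
  have hSrC : ∀ (j : ℕ) (α κ' : Fin 4) (u : Fin 4 → ℤ),
      (JsB12CombSh0 hLc N tabs cΛ cB j).S κ' (bref α κ' u) =
        reflSign α κ' • refK (Φ Lc α) ((JsB12CombSh0 hLc N tabs cΛ cB j).S κ' u +
          conjV (bhKStepSh 3 Lc (Dsh Lc) j) (diagK (fun p a => γ j * ctGenM 3 (bhK Lc + Dsh Lc) α Lc κ' u p a))) := fun j α κ' u => by
    rw [← smul_diagK, hγ]
    exact hSrC_JsB12CombSh0 hLc N tabs cΛ cB (hVfm α) (hVmf α) (hVmm α) hV0 hHr j κ' u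
  have hC : ∀ (j : ℕ) (α : Fin 4), LocStencil (fun κ u => diagK (fun p a => γ j * ctGenM 3 (bhK Lc + Dsh Lc) α Lc κ u p a))
      (|γ j| * (1 + ((Lc : ℝ) ^ (3 + 1))⁻¹ * CB)) (δB / 2) := fun j α => by
    have h := locStencil_smul_diagK_ctGenM hBd hδB.le (γ j) α Lc
    simp only [smul_diagK] at h
    exact h
  refine ⟨wardTransversal_flipK_TbalOf_JsB12CombShSym_rel_parity hLc N tabs cΛ cB
    (fun j y => (1 / 2 : ℝ) • ∑ v ∈ box 4 Lc, legInd (ctr 4 Lc) ((Lc : ℤ) • y + toSite v)) (fun j y => loc_diagK_smul_sum_legInd Lc _ (1 / 2 : ℝ) y)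
    (fun _ _ _ _ => 0) (fun _ _ _ _ => loc_zero) hEX₂ Nr
    (fun j y ν y' => by obtain ⟨C, δ, hδ, h⟩ := hcls j; exact ⟨_, _, _, δ, hδ, h y ν y'⟩)
    (hSd_JsB12CombSh0 hLc N tabs cΛ cB hVd) hWd hpar, ?_⟩
  exact axisReflectionCovariant_flipK_TbalOf_JsB12CombShSym_of_reflLettersRem hLc N tabs cΛ cB
    (fun j α κ u => fun p a => γ j * ctGenM 3 (bhK Lc + Dsh Lc) α Lc κ u p a) (fun j => |γ j| * (1 + ((Lc : ℝ) ^ (3 + 1))⁻¹ * CB)) (fun _ => δB / 2)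
    hC (fun _ => half_pos hδB) x₂ hX₂ Rm hRmL hRm0 hSrC hWrC

/-- [folklore] **hW ∧ hR TWIN of `CombChartJointEndTablesFold.d1Drift_JsB12CombShSym_of_wardTables_multiplierTable_reflLetters_D1Tel_D1Rep`** (ROOT chain F′ … M‴ of row D1, chart (III′)): the SAME letters, the conclusion
replaced by the Ward transversality and the axis-reflection covariance of the flipped step kernels `flipK (TbalOf Lc (JsB12CombShSym …) j)`, every `j`;
proof = the original body with its callee replaced by the callee's twin (route binders dropped). -/
theorem wardRefl_JsB12CombShSym_of_wardTables_multiplierTable_reflLetters (hLc : Odd Lc) (N : ℕ) (tabs : SymTables 3 Lc) (cΛ cB : ℝ)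
    -- hW, first order: the (0.4) stencil Ward law of `tabs.V` ((S-V)⁰⁴)
    (hVd04 : ∀ u : Fin 4 → ℤ, divV tabs.V u = conjV (mfNeg (linSym04At (ctr 4 Lc) Lc)) (diagK (legInd (ctr 4 Lc) u)))
    -- hW, SECOND ORDER — (M-H) THE MULTIPLIER TABLES ARE THE `M1Of`-TABLES OF THE CONSTRAINT HESSIAN (replaces (c1)′, now the theorem
    -- `LagrangeFoldComb.dM_SpureCombOf_M1Of_eq_vertexOfK_ScombOf`), (Sp)(Mp), the table letters
    (hM1 : ∀ (j : ℕ) (ρ : Fin 4) (w : Fin 4 → ℤ), tabs.M j ρ w = M1Of 3 Lc tabs.H cΛ j ρ w)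
    (hSp : ∀ (j : ℕ) (κ : Fin 4) (u : Fin 4 → ℤ), trK (SpureCombOf tabs ((Lc : ℝ) ^ (3 + 1)) (-((Lc : ℝ) ^ (3 + 1) * (1 / 2) * (Lc : ℝ) ^ (3 + 1))) cΛ j κ u) = -sgnK (SpureCombOf tabs ((Lc : ℝ) ^ (3 + 1)) (-((Lc : ℝ) ^ (3 + 1) * (1 / 2) * (Lc : ℝ) ^ (3 + 1))) cΛ j κ u))
    (hMp : ∀ (j : ℕ) (ρ : Fin 4) (w : Fin 4 → ℤ), trK (tabs.M j ρ w) = -sgnK (tabs.M j ρ w))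
    (RW RW'' : (Fin 4 → ℤ) → Fin 4 → (Fin 4 → ℤ) → MKer 4 (Fib 3))
    (RB RB'' : ℕ → (Fin 4 → ℤ) → Fin 4 → (Fin 4 → ℤ) → MKer 4 (Fib 3))
    (RM : ℕ → (Fin 4 → ℤ) → Fin 4 → (Fin 4 → ℤ) → MKer 4 (Fib 3))
    (hcls0 : ∃ C δ : ℝ, 0 < δ ∧ (∀ Y, LocStencil (RW Y) C δ) ∧ (∀ Y, LocStencil (RW'' Y) C δ) ∧ (∀ Y, LocStencil (RB 0 Y) C δ) ∧
      (∀ Y, LocStencil (RB'' 0 Y) C δ) ∧ (∀ y, VertexFamily (RM 0 y) Lc C δ))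
    (hclsS : ∀ j : ℕ, ∃ C δ : ℝ, 0 < δ ∧ (∀ Y, LocStencil (RB (j + 1) Y) C δ) ∧ (∀ Y, LocStencil (RB'' (j + 1) Y) C δ) ∧
      (∀ y, VertexFamily (RM (j + 1) y) Lc C δ))
    (hRWp : ∀ Y κ u, trK (RW Y κ u) = -sgnK (RW Y κ u)) (hRW''p : ∀ Y κ u, trK (RW'' Y κ u) = -sgnK (RW'' Y κ u))
    (hRBp : ∀ j Y κ u, trK (RB j Y κ u) = -sgnK (RB j Y κ u)) (hRB''p : ∀ j Y κ u, trK (RB'' j Y κ u) = -sgnK (RB'' j Y κ u))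
    (hRMp : ∀ j y ρ' w, trK (RM j y ρ' w) = -sgnK (RM j y ρ' w))
    (hWil : ∀ (Y : Fin 4 → ℤ) (κ' : Fin 4) (u' : Fin 4 → ℤ),
      (stepScale 3 Lc 0 * (Lc : ℝ) ^ (3 + 1))⁻¹ • ∑ v ∈ box (3 + 1) Lc,
          divV (fun κ u => ((Lc : ℝ) ^ 8) • wilsonW₂ 3 ((8 * (N : ℝ) ^ 2)⁻¹ • wsym22 N) κ u κ' u') ((Lc : ℤ) • Y + toSite v) =
        comp (((Lc : ℝ) ^ (3 + 1)) • wilsonA 3 κ' u') (diagK ((1 / 2 : ℝ) • ∑ v ∈ box (3 + 1) Lc, legInd (ctr (3 + 1) Lc) ((Lc : ℤ) • Y + toSite v)))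
          - comp (diagK ((1 / 2 : ℝ) • ∑ v ∈ box (3 + 1) Lc, legInd (ctr (3 + 1) Lc) ((Lc : ℤ) • Y + toSite v))) (((Lc : ℝ) ^ (3 + 1)) • wilsonA 3 κ' u') + RW Y κ' u')
    (hWil'' : ∀ (Y : Fin 4 → ℤ) (κ : Fin 4) (u : Fin 4 → ℤ),
      (stepScale 3 Lc 0 * (Lc : ℝ) ^ (3 + 1))⁻¹ • ∑ v ∈ box (3 + 1) Lc,
          divV (fun κ' u' => ((Lc : ℝ) ^ 8) • wilsonW₂ 3 ((8 * (N : ℝ) ^ 2)⁻¹ • wsym22 N) κ u κ' u') ((Lc : ℤ) • Y + toSite v) =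
        comp (((Lc : ℝ) ^ (3 + 1)) • wilsonA 3 κ u) (diagK ((1 / 2 : ℝ) • ∑ v ∈ box (3 + 1) Lc, legInd (ctr (3 + 1) Lc) ((Lc : ℤ) • Y + toSite v)))
          - comp (diagK ((1 / 2 : ℝ) • ∑ v ∈ box (3 + 1) Lc, legInd (ctr (3 + 1) Lc) ((Lc : ℤ) • Y + toSite v))) (((Lc : ℝ) ^ (3 + 1)) • wilsonA 3 κ u) + RW'' Y κ u)
    (hBord0 : ∀ (Y : Fin 4 → ℤ) (κ' : Fin 4) (u' : Fin 4 → ℤ),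
      (stepScale 3 Lc 0 * (Lc : ℝ) ^ (3 + 1))⁻¹ • ∑ v ∈ box (3 + 1) Lc, divV (fun κ u => cB • tabs.vh₂S κ u κ' u') ((Lc : ℤ) • Y + toSite v) =
        comp ((-((Lc : ℝ) ^ (3 + 1) * (1 / 2) * (Lc : ℝ) ^ (3 + 1))) • tabs.V κ' u') (diagK ((1 / 2 : ℝ) • ∑ v ∈ box (3 + 1) Lc, legInd (ctr (3 + 1) Lc) ((Lc : ℤ) • Y + toSite v)))
          - comp (diagK ((1 / 2 : ℝ) • ∑ v ∈ box (3 + 1) Lc, legInd (ctr (3 + 1) Lc) ((Lc : ℤ) • Y + toSite v))) ((-((Lc : ℝ) ^ (3 + 1) * (1 / 2) * (Lc : ℝ) ^ (3 + 1))) • tabs.V κ' u') + RB 0 Y κ' u')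
    (hBord0'' : ∀ (Y : Fin 4 → ℤ) (κ : Fin 4) (u : Fin 4 → ℤ),
      (stepScale 3 Lc 0 * (Lc : ℝ) ^ (3 + 1))⁻¹ • ∑ v ∈ box (3 + 1) Lc, divV (fun κ' u' => cB • tabs.vh₂S κ u κ' u') ((Lc : ℤ) • Y + toSite v) =
        comp ((-((Lc : ℝ) ^ (3 + 1) * (1 / 2) * (Lc : ℝ) ^ (3 + 1))) • tabs.V κ u) (diagK ((1 / 2 : ℝ) • ∑ v ∈ box (3 + 1) Lc, legInd (ctr (3 + 1) Lc) ((Lc : ℤ) • Y + toSite v)))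
          - comp (diagK ((1 / 2 : ℝ) • ∑ v ∈ box (3 + 1) Lc, legInd (ctr (3 + 1) Lc) ((Lc : ℤ) • Y + toSite v))) ((-((Lc : ℝ) ^ (3 + 1) * (1 / 2) * (Lc : ℝ) ^ (3 + 1))) • tabs.V κ u) + RB'' 0 Y κ u)
    (hBordS : ∀ (j : ℕ) (Y : Fin 4 → ℤ) (κ' : Fin 4) (u' : Fin 4 → ℤ),
      (stepScale 3 Lc (j + 1) * (Lc : ℝ) ^ (3 + 1))⁻¹ • ∑ v ∈ box (3 + 1) Lc, divV (fun κ u => (cB * wB2 3 Lc (j + 1)) • tabs.vh₂S κ u κ' u') ((Lc : ℤ) • Y + toSite v) =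
        comp (((-((Lc : ℝ) ^ (3 + 1) * (1 / 2) * (Lc : ℝ) ^ (3 + 1))) * wVH 3 Lc (j + 1)) • tabs.V κ' u') (diagK ((1 / 2 : ℝ) • ∑ v ∈ box (3 + 1) Lc, legInd (ctr (3 + 1) Lc) ((Lc : ℤ) • Y + toSite v)))
          - comp (diagK ((1 / 2 : ℝ) • ∑ v ∈ box (3 + 1) Lc, legInd (ctr (3 + 1) Lc) ((Lc : ℤ) • Y + toSite v))) (((-((Lc : ℝ) ^ (3 + 1) * (1 / 2) * (Lc : ℝ) ^ (3 + 1))) * wVH 3 Lc (j + 1)) • tabs.V κ' u') + RB (j + 1) Y κ' u')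
    (hBordS'' : ∀ (j : ℕ) (Y : Fin 4 → ℤ) (κ : Fin 4) (u : Fin 4 → ℤ),
      (stepScale 3 Lc (j + 1) * (Lc : ℝ) ^ (3 + 1))⁻¹ • ∑ v ∈ box (3 + 1) Lc, divV (fun κ' u' => (cB * wB2 3 Lc (j + 1)) • tabs.vh₂S κ u κ' u') ((Lc : ℤ) • Y + toSite v) =
        comp (((-((Lc : ℝ) ^ (3 + 1) * (1 / 2) * (Lc : ℝ) ^ (3 + 1))) * wVH 3 Lc (j + 1)) • tabs.V κ u) (diagK ((1 / 2 : ℝ) • ∑ v ∈ box (3 + 1) Lc, legInd (ctr (3 + 1) Lc) ((Lc : ℤ) • Y + toSite v)))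
          - comp (diagK ((1 / 2 : ℝ) • ∑ v ∈ box (3 + 1) Lc, legInd (ctr (3 + 1) Lc) ((Lc : ℤ) • Y + toSite v))) (((-((Lc : ℝ) ^ (3 + 1) * (1 / 2) * (Lc : ℝ) ^ (3 + 1))) * wVH 3 Lc (j + 1)) • tabs.V κ u) + RB'' (j + 1) Y κ u)
    (hM₂ : ∀ (j : ℕ) (y : Fin 4 → ℤ) (ρ' : Fin 4) (w : Fin 4 → ℤ),
      (stepScale 3 Lc j * (Lc : ℝ) ^ (3 + 1))⁻¹ • ∑ v ∈ box (3 + 1) Lc, divV (fun κ u => M2Of 3 Lc tabs.mixFF j κ u ρ' w) ((Lc : ℤ) • y + toSite v) =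
        comp (tabs.M j ρ' w) (diagK ((1 / 2 : ℝ) • ∑ v ∈ box (3 + 1) Lc, legInd (ctr (3 + 1) Lc) ((Lc : ℤ) • y + toSite v))) - comp (diagK ((1 / 2 : ℝ) • ∑ v ∈ box (3 + 1) Lc, legInd (ctr (3 + 1) Lc) ((Lc : ℤ) • y + toSite v))) (tabs.M j ρ' w) + RM j y ρ' w)
    -- hR, first order: the tables' REFLECTION letters (V-r)(V-ff0)(H-r)
    (hVfm : ∀ (α κ' : Fin 4) (u x z : Fin 4 → ℤ) (β m : Fin 4), tabs.V κ' (bref α κ' u) x z (Sum.inl β) (Sum.inr m) =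
      (reflSign α κ' • refK (Φ (d := 3) Lc α) (tabs.V κ' u + conjV (bhK (d := 3) Lc + Dsh Lc)
        ((((Lc : ℝ) ^ 4)⁻¹) • diagK (ctGenM 3 (bhK Lc + Dsh Lc) α Lc κ' u)))) x z (Sum.inl β) (Sum.inr m))
    (hVmf : ∀ (α κ' : Fin 4) (u x z : Fin 4 → ℤ) (m β : Fin 4), tabs.V κ' (bref α κ' u) x z (Sum.inr m) (Sum.inl β) =
      (reflSign α κ' • refK (Φ (d := 3) Lc α) (tabs.V κ' u + conjV (bhK (d := 3) Lc + Dsh Lc)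
        ((((Lc : ℝ) ^ 4)⁻¹) • diagK (ctGenM 3 (bhK Lc + Dsh Lc) α Lc κ' u)))) x z (Sum.inr m) (Sum.inl β))
    (hVmm : ∀ (α κ' : Fin 4) (u x z : Fin 4 → ℤ) (m m' : Fin 4), tabs.V κ' (bref α κ' u) x z (Sum.inr m) (Sum.inr m') =
      (reflSign α κ' • refK (Φ (d := 3) Lc α) (tabs.V κ' u + conjV (bhK (d := 3) Lc + Dsh Lc)
        ((((Lc : ℝ) ^ 4)⁻¹) • diagK (ctGenM 3 (bhK Lc + Dsh Lc) α Lc κ' u)))) x z (Sum.inr m) (Sum.inr m'))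
    (hV0 : ∀ (κ : Fin 4) (w x z : Fin 4 → ℤ) (β β' : Fin 4), tabs.V κ w x z (Sum.inl β) (Sum.inl β') = 0)
    (hHr : ∀ (α μ : Fin 4) (y : Fin 4 → ℤ), tabs.H μ (bref α μ y) = reflSign α μ • refK (Φ (d := 3) Lc α) (tabs.H μ y))
    -- the first-order contact coefficient, displayed
    (γ : ℕ → ℝ) (hγ : ∀ j, γ j = -((Lc : ℝ) ^ 8 / 2) * wVH 3 Lc j / (stepScale 3 Lc j * (Lc : ℝ) ^ 4))
    -- hR, second order: the reflection letter (Wr-conj-rem) of the undressed comb-chart jets with the PINNED first-order contacts, diagonal `X₂`, tadpole-null remainder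
    (x₂ : ℕ → Fin 4 → Fin 4 → (Fin 4 → ℤ) → Fin 4 → (Fin 4 → ℤ) → (Fin 4 → ℤ) → Fib 3 → ℝ)
    (hX₂ : ∀ j α μ y ν y', Loc (diagK (x₂ j α μ y ν y')))
    (Rm : ℕ → Fin 4 → Fin 4 → (Fin 4 → ℤ) → Fin 4 → (Fin 4 → ℤ) → MKer 4 (Fib 3))
    (hRmL : ∀ j α μ y ν y', Loc (Rm j α μ y ν y'))
    (hRm0 : ∀ j α μ y ν y', tadpole (GcombSh Lc j) (Rm j α μ y ν y') = 0)
    (hWrC : ∀ (j : ℕ) (α μ : Fin 4) (y : Fin 4 → ℤ) (ν : Fin 4) (y' : Fin 4 → ℤ),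
      (JsB12CombSh0 hLc N tabs cΛ cB j).W μ (bref α μ y) ν (bref α ν y') = (reflSign α μ * reflSign α ν) • refK (Φ Lc α)
        ((JsB12CombSh0 hLc N tabs cΛ cB j).W μ y ν y' +
          conjW (bhKStepSh 3 Lc (Dsh Lc) j) (vertexOfK (GcombSh Lc j) Lc (JsB12CombSh0 hLc N tabs cΛ cB j).S μ y)
            (vertexOfK (GcombSh Lc j) Lc (JsB12CombSh0 hLc N tabs cΛ cB j).S ν y')
            (vertexOfK (GcombSh Lc j) Lc (fun κ u => diagK (fun p a => γ j * ctGenM 3 (bhK Lc + Dsh Lc) α Lc κ u p a)) μ y)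
            (vertexOfK (GcombSh Lc j) Lc (fun κ u => diagK (fun p a => γ j * ctGenM 3 (bhK Lc + Dsh Lc) α Lc κ u p a)) ν y')
            (diagK (x₂ j α μ y ν y')) + Rm j α μ y ν y')) :
    (∀ j : ℕ, WardTransversal (flipK (TbalOf Lc (JsB12CombShSym hLc N tabs cΛ cB) j))) ∧
      (∀ j : ℕ, AxisReflectionCovariant (flipK (TbalOf Lc (JsB12CombShSym hLc N tabs cΛ cB) j))) :=
  wardRefl_JsB12CombShSym_of_wardTables_reflLetters hLc N tabs cΛ cB hVd04
    (fun j κ u => by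
      have e : tabs.M j = M1Of 3 Lc tabs.H cΛ j := funext fun ρ => funext fun w => hM1 j ρ w
      rw [e]
      exact dM_SpureCombOf_M1Of_eq_vertexOfK_ScombOf (d := 3) tabs _ _ cΛ j κ u)
    hSp hMp RW RW'' RB RB'' RM hcls0 hclsS hRWp hRW''p hRBp hRB''p hRMp hWil hWil'' hBord0 hBord0'' hBordS hBordS'' hM₂
    hVfm hVmf hVmm hV0 hHr γ hγ x₂ hX₂ Rm hRmL hRm0 hWrC

end Summit.QuantumFields.BalabanUV.Beta.FP.StepKernelWardDataTables

end
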